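import Literature.AlgebraicGeometry.Frobenioids.PreFrobenioidDataOfModel
import Literature.AlgebraicGeometry.Frobenioids.ModelFrobenioidUnits
import Literature.AnabelianGeometry.EtaleTheta.FrobenioidTheta

/-!
# [EtTh] §5 merge adapter I: the Frobenioid-level vocabulary of `ThetaFrobenioid` from a model Frobenioid

Mochizuki, *The étale theta function and its Frobenioid-theoretic manifestations*, Publ. RIMS **45**
(2009) [cite: MochizukiEtTh2009, §5 p.322 (PDF p.96)]; *The geometry of Frobenioids I*, Kyushu J.
Math. **62** (2008) [cite: MochizukiFrdI2008, Thm. 5.2(ii) p.101].  abc-iut cell, layer L2, unit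
W2-L2-05 (merge adapter t3/found/L1 → t4), seat abc-iut-L2-t9.

`FrobenioidTheta.lean` (seat abc-iut-L2-t4) types the §5 setting over the hypothesis structure
`FrobenioidTheta.TemperedFrobenioidStub C D` = the tree's `PreFrobenioidData` (`pre`: `Base`, `Div`,
`deg_Fr`, whence `O^×(S)`, linear, pre-step, …) plus the §4/§5 extras the tree lacked: `O^×(S)` abelian,
`O^×(S^birat)`, "the natural inclusion `O^×(S) ↪ O^×(S^birat)`", pull-back of units, morphisms of
base-Frobenius type — tagged `TODO-merge(abc-iut-found, abc-iut-L2-t3)`.  By [EtTh] Def. 3.6 (ii)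
(p.303 (PDF p.77)) a tempered Frobenioid IS the model Frobenioid ([FrdI] Thm. 5.2) of data
`(D, Φ, B, B → Φ^gp)` (for abc-iut-L2-t3's `TemperedFrobenioid` that category is
`TemperedFrobenioid.model`, file `TemperedFrobenioidModel.lean`); so the honest instantiation of the
stub is over the tree's `Frobenioids.ModelFrobenioid Φ B Div_B` (seat abc-iut-L1-t2) with abc-iut-L1-t3's
`PreFrobenioidData.ofModel` ([FrdI] Thm. 5.2 (i), last sentence) and the explicit units of
`ModelFrobenioidUnits.lean` ([FrdI] Thm. 5.2 (ii): "`O^×(−)` on `C^birat` is `B`").  This file: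

* `TemperedFrobenioidStub.ofModel` — EVERY field of the stub REAL over `(D, Φ, B, Div_B)` except one:
  `IsBaseFrobeniusType` ([EtTh] Def. 4.1 (iv)), which needs "arise from a base-Frobenius pair"
  ([FrdI] Def. 2.7 (iii), seat abc-iut-L1-t2, not landed) and the Galois objects of `D` ([SemiAnbd],
  layer L3) — it stays the ONE parameter `IsBFT` (abc-iut-L2-t3's `BiKummerSetting.IsOfBaseFrobeniusType`
  is its definition over t3's own hypothesis structure; `TODO-merge(abc-iut-L2-t3, abc-iut-L1-t2)`);
* the dictionary (`ofModel_*`): each stub field unfolds to the L1 / model declaration by `rfl`;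
* what abc-iut-L2-t4's definitions over the stub become for the model: a member of `μ_M(S)` is a
  base-identity linear automorphism whose `u_α ∈ B(S^bs)^×` is `M`-torsion
  (`ThetaFrobenioid.unitsToRatFn_pow_eq_one_of_mem_muTorsion`); `u_α ∈ Ker(Div_B)` for sharp
  `Φ(S^bs)` (`divB_unitsToBirat_eq_one`).

Universes: the stub (v3, p405154) takes `C`, `D` in independent universes and `Φ`, `O^×(S^birat)` in a
third one `w`, so the model Frobenioid (`Type (max u w)`, morphisms in `Type (max v w)`) over any
`D : Type u`, `[Category.{v} D]`, `Φ, B : Dᵒᵖ ⥤ CommMonCat.{w}` instantiates it with no constraint.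
HONEST FRAMING: nothing here asserts that the §5 data exist for an actual once-punctured elliptic
curve; typed ≠ proved; no side is taken on any disputed claim.
-/

noncomputable section

namespace Literature.AnabelianGeometry.EtaleTheta

namespace FrobenioidTheta

open CategoryTheory Opposite Literature.AlgebraicGeometry.Frobenioids

universe w v u

variable {D : Type u} [Category.{v} D] (Φ B : Dᵒᵖ ⥤ CommMonCat.{w}) (DivB : B ⟶ monoidGp Φ)

/-- **The Frobenioid-level §5 vocabulary of the model Frobenioid** `C = ModelFrobenioid Φ B Div_B`
over `D` ([EtTh] Def. 3.6 (ii): "the data `(D, Φ, B, B → Φ^gp)` determines a model Frobenioid `C`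
[cf. [FrdI], Theorem 5.2, (ii)]. We shall refer to a Frobenioid `C` obtained in this way as a tempered
Frobenioid"), instantiating abc-iut-L2-t4's `TemperedFrobenioidStub`: `pre` = the model's
`(Base, Div, deg_Fr)` (`PreFrobenioidData.ofModel`), so `O^×(S)` = base-identity linear automorphisms
([FrdI] Def. 1.2 (ii)); `O^×(S^birat) := B(S^bs)^×` ([FrdI] Thm. 5.2 (ii)); `O^×(S) ↪ O^×(S^birat)` =
`α ↦ u_α`; pull-back of units = transport along `B(Base φ)`, `Φ(Base φ)`.  Parameters: `hΦ` — `Φ`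
is objectwise integral (part of "divisorial", [FrdI] Def. 1.1 (i); needed for the injectivity of
`O^×(S) → B(S^bs)`); `IsBFT` — the class of morphisms of base-Frobenius type ([EtTh] Def. 4.1 (iv);
`TODO-merge(abc-iut-L2-t3, abc-iut-L1-t2)`). [cite: MochizukiEtTh2009, Def 3.6 p.303 (PDF p.77)] -/
def TemperedFrobenioidStub.ofModel (hΦ : ∀ A : Dᵒᵖ, IsIntegral (Φ.obj A))
    (IsBFT : MorphismProperty (ModelFrobenioid Φ B DivB)) :
    TemperedFrobenioidStub.{w} (ModelFrobenioid Φ B DivB) D where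
  pre := PreFrobenioidData.ofModel Φ B DivB
  units_comm S := ModelFrobenioid.isMulCommutative_units S
  biratUnits S := (B.obj (op S.base))ˣ
  unitsToBirat S := ModelFrobenioid.unitsToRatFn S
  unitsToBirat_injective _ := ModelFrobenioid.unitsToRatFn_injective (hΦ _)
  unitsPull φ := ModelFrobenioid.unitsPull φ
  IsBaseFrobeniusType := IsBFT

variable {Φ B DivB} (hΦ : ∀ A : Dᵒᵖ, IsIntegral (Φ.obj A))
  (IsBFT : MorphismProperty (ModelFrobenioid Φ B DivB))

/-! ### Dictionary: every stub field is the L1 / model declaration -/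

/-- The operations of the stub are abc-iut-L1-t3's `PreFrobenioidData.ofModel` ([FrdI] Thm. 5.2 (i),
last sentence). [cite: MochizukiEtTh2009, §5 p.322 (PDF p.96)] -/
theorem ofModel_pre : (TemperedFrobenioidStub.ofModel Φ B DivB hΦ IsBFT).pre =
    PreFrobenioidData.ofModel Φ B DivB := rfl

/-- `O^×(S)` of the stub (`pre.unitsSubgroup S`, [FrdI] Def. 1.2 (ii)) is `ModelFrobenioid.units S`.
[cite: MochizukiEtTh2009, §5 p.331 (PDF p.105)] -/
theorem ofModel_unitsSubgroup (S : ModelFrobenioid Φ B DivB) :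
    (TemperedFrobenioidStub.ofModel Φ B DivB hΦ IsBFT).pre.unitsSubgroup S = ModelFrobenioid.units S :=
  Subgroup.ext fun _ => Iff.rfl

/-- Membership in `O^×(S)`: `Base(α) = id` and `deg_Fr(α) = 1`. [cite: MochizukiEtTh2009, §5 p.331 (PDF p.105)] -/
theorem mem_ofModel_unitsSubgroup_iff {S : ModelFrobenioid Φ B DivB} (α : Aut S) :
    α ∈ (TemperedFrobenioidStub.ofModel Φ B DivB hΦ IsBFT).pre.unitsSubgroup S ↔
      ModelFrobenioid.baseMap α.hom = 𝟙 S.base ∧ ModelFrobenioid.degFr α.hom = 1 := Iff.rfl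

/-- `O^×(S^birat) = B(S^bs)^×` ([FrdI] Thm. 5.2 (ii)) and `O^×(S) → O^×(S^birat)` is `α ↦ u_α`.
[cite: MochizukiEtTh2009, §5 p.331 (PDF p.105)] -/
theorem ofModel_unitsToBirat_apply {S : ModelFrobenioid Φ B DivB}
    (α : (TemperedFrobenioidStub.ofModel Φ B DivB hΦ IsBFT).pre.unitsSubgroup S) :
    ((show (B.obj (op S.base))ˣ from (TemperedFrobenioidStub.ofModel Φ B DivB hΦ IsBFT).unitsToBirat S α :
        (B.obj (op S.base))ˣ) : B.obj (op S.base)) = ModelFrobenioid.unit α.1.hom := rfl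

/-- Pull-back of units along `φ` is `u ↦ B(Base φ)(u)` on `O^×(S^birat) = B`.
[cite: MochizukiEtTh2009, Prop 5.5 p.328 (PDF p.102)] -/
theorem ofModel_unitsPull_toBirat {S T : ModelFrobenioid Φ B DivB} (φ : S ⟶ T)
    (τ : (TemperedFrobenioidStub.ofModel Φ B DivB hΦ IsBFT).pre.unitsSubgroup T) :
    ((show (B.obj (op S.base))ˣ from (TemperedFrobenioidStub.ofModel Φ B DivB hΦ IsBFT).unitsToBirat S
        ((TemperedFrobenioidStub.ofModel Φ B DivB hΦ IsBFT).unitsPull φ τ) : (B.obj (op S.base))ˣ) :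
        B.obj (op S.base)) =
      (B.map (ModelFrobenioid.baseMap φ).op).hom (ModelFrobenioid.unit τ.1.hom) := rfl

/-- The pulled-back unit intertwines a LINEAR `φ`: `unitsPull φ τ ≫ φ = φ ≫ τ` ([FrdI] Prop. 2.2
(ii)–(iii): `O^×(−)` is functorial for linear morphisms; [EtTh] Prop. 5.5, p.328 (PDF p.102)).
[cite: MochizukiEtTh2009, Prop 5.5 p.328 (PDF p.102)] -/
theorem ofModel_unitsPull_comp {S T : ModelFrobenioid Φ B DivB} (φ : S ⟶ T)
    (hφ : (TemperedFrobenioidStub.ofModel Φ B DivB hΦ IsBFT).pre.IsLinear φ)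
    (τ : (TemperedFrobenioidStub.ofModel Φ B DivB hΦ IsBFT).pre.unitsSubgroup T) :
    ((TemperedFrobenioidStub.ofModel Φ B DivB hΦ IsBFT).unitsPull φ τ).1.hom ≫ φ = φ ≫ τ.1.hom :=
  ModelFrobenioid.comp_eq_unitsPull_comp φ hφ τ

/-! ### What abc-iut-L2-t4's definitions over the stub become for the model -/

/-- In the model, a unit `α ∈ O^×(S)` has `Div(α) = 0` and `u_α ∈ Ker(Div_B)` as soon as `Φ(S^bs)` is
sharp (divisorial `Φ`): "compatible with the homomorphisms `O^×(−) → Φ^gp`" ([FrdI] Thm. 5.2 (ii)).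
[cite: MochizukiEtTh2009, §5 p.331 (PDF p.105)] -/
theorem divB_unitsToBirat_eq_one {S : ModelFrobenioid Φ B DivB} (hS : IsSharp (Φ.obj (op S.base)))
    (α : (TemperedFrobenioidStub.ofModel Φ B DivB hΦ IsBFT).pre.unitsSubgroup S) :
    divB Φ B DivB (op S.base)
        (show (B.obj (op S.base))ˣ from (TemperedFrobenioidStub.ofModel Φ B DivB hΦ IsBFT).unitsToBirat S α) =
      1 :=
  ModelFrobenioid.divB_unitsToRatFn_eq_one hS α

end FrobenioidTheta

namespace ThetaFrobenioid

open CategoryTheory Opposite Literature.AlgebraicGeometry.Frobenioids FrobenioidTheta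

universe w v u

variable {D : Type u} [Category.{v} D] {Φ B : Dᵒᵖ ⥤ CommMonCat.{w}} {DivB : B ⟶ monoidGp Φ}

/-- For a §5 theta Frobenioid whose Frobenioid-level vocabulary IS the model one
(`𝔉.toTemperedFrobenioidStub = ofModel …`), abc-iut-L2-t4's cyclotome `μ_M(S)` ([FrdII] Def. 2.1 (i);
[EtTh] Def. 5.4: "`μ_N(S) (= l·μ_{l·N}(S))`") consists of base-identity linear automorphisms whose
rational function `u_α ∈ B(S^bs)^×` is `M`-torsion — `O^×(S) ↪ O^×(S^birat)` maps `μ_M(S)` into the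
`M`-torsion of `B(S^bs)^×`. [cite: MochizukiEtTh2009, Def 5.4 p.327 (PDF p.101)] -/
theorem unitsToRatFn_pow_eq_one_of_mem_muTorsion (𝔉 : ThetaFrobenioid.{w} (ModelFrobenioid Φ B DivB) D)
    {hΦ : ∀ A : Dᵒᵖ, IsIntegral (Φ.obj A)} {IsBFT : MorphismProperty (ModelFrobenioid Φ B DivB)}
    (h𝔉 : 𝔉.toTemperedFrobenioidStub = TemperedFrobenioidStub.ofModel Φ B DivB hΦ IsBFT)
    {S : ModelFrobenioid Φ B DivB} {M : ℕ} {u : Aut S} (hu : u ∈ 𝔉.muTorsion S M) :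
    ∃ hu' : u ∈ ModelFrobenioid.units S, (ModelFrobenioid.unitsToRatFn S ⟨u, hu'⟩) ^ M = 1 := by
  obtain ⟨hu₁, hu₂⟩ := hu
  have hu' : u ∈ ModelFrobenioid.units S := by
    have : u ∈ 𝔉.toTemperedFrobenioidStub.pre.unitsSubgroup S := hu₁
    rw [h𝔉] at this
    exact this
  refine ⟨hu', ?_⟩
  rw [← map_pow]
  have : (⟨u, hu'⟩ : ModelFrobenioid.units S) ^ M = 1 := Subtype.ext hu₂
  rw [this, map_one]

end ThetaFrobenioid

end Literature.AnabelianGeometry.EtaleTheta
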